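import Summits.CriticalPhenomena.Ising3DConformalLimit.Theses.CoerciveSharpness
import Literature.Probability.LatticeModels.SharpLengthDCPTorus
import HarnessLib

/-!
# Vocabulary of line `base_box_rerun` for crux `CoerciveReflectedGradient` (stmt-CriticalPhenomena-18197)

Route `CoerciveSharpness` (sub-problem `CriticalPhenomena/Ising3DConformalLimit`), crux
`Summit.CriticalPhenomena.Ising3DConformalLimit.Theses.CoerciveSharpness.CoerciveReflectedGradient`
(item stmt-CriticalPhenomena-18197): `PhiCoercive → (the Duminil-Copin–Panis reflected gradient
Q(n) on ℤ³ at β_c is ≥ c₀ n^κ' eventually)`. This file is the **definitions module** of the checked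
skeleton `Cruxes/CoerciveReflectedGradient/Lines/base_box_rerun.lean` (crux-strategist
planner-cstrat-stmt-CriticalPhenomena-18197-b1-0, lead prover-line-stmt-CriticalPhenomena-18197-0,
`ledger skeleton check` OK, six registered stubs `stub_boxPointwise`, `stub_boxTorus`,
`stub_boxInfiniteVolume`, `stub_headSmall`, `stub_reflectedSumIdentity`, `stub_growthSelection`): it
carries, sorry-free, the skeleton's VOCABULARY — the base-box boundary input `BoxInput` (the coercive
form of eq. (2.5) of Duminil-Copin–Panis §2.2 in weight form), the two intermediate inequalities
`BoxTorusIneq` / `BoxInfiniteVolume` (base-box twins of the conclusions of the tree's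
`DCPNearCritical.torusIneq_of_lemma25_weight` / `infiniteVolume_ineq_of_lemma25`), the crux's reflected
gradient `Qcrux` (VERBATIM the right-hand side of the crux consequent) and the six registered stub
statements `Sig.stub_*` — so that the stub helper files
`Theorems/CoerciveSharpnessCoerciveReflectedGradient<StubName>.lean` (each proving
`theorem <stubName> : Sig.<stubName>` by name, `--supports stmt-CriticalPhenomena-18197`) and the closing
skeleton file share ONE copy of every object. Nothing in this file is asserted: every `def … : Prop` is a
statement to be proved by a registered stub or composed by the skeleton's kernel-checked glue
`CoerciveReflectedGradient_of`.

The line (Duminil-Copin–Panis, CMP 406 (2025) = arXiv:2404.05700, §2.2 rerun with a base box): the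
tree's PROVED torus route to Theorem 1.2 (`DCPNearCritical.pointwise_master_weight` →
`torusIneq_of_lemma25_weight` → `infiniteVolume_ineq_of_lemma25` → `direction_sum_const` + Lemma 2.4,
`Literature/Probability/LatticeModels/SharpLengthDCPTorus.lean`) with the BASE POINT `0` of the random
set `𝒮_n` replaced by a BASE BOX `Λ_m`, `m ≍ n^{1/3}`: on `{Λ_m ⊆ 𝒮_n}` the coercive input
(`PhiCoercive`, all finite supersets of `Λ_m`) replaces `φ ≥ 1/2`; the complementary event costs the
union bound `Σ_{z ∈ Λ_m} Σ_δ ⟨σ_z σ_{𝓡_δ z}⟩ ≤ C m³/n` (Lemma 2.4 at base point `z̄` + infrared bound).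

Sources: H. Duminil-Copin, R. Panis, *New lower bounds for the (near) critical Ising and φ⁴ models'
two-point functions*, Comm. Math. Phys. 406 (2025), arXiv:2404.05700, §2.2 (Lemmas 2.3–2.5,
eqs. (2.5)–(2.8), (2.20)–(2.24)), Theorem 1.2.
-/

noncomputable section

open Finset
open scoped BigOperators Classical

namespace Summit.CriticalPhenomena.Ising3DConformalLimit.Cruxes.CoerciveReflectedGradient.BaseBoxRerun

open Literature.Probability.LatticeModels
open Literature.Probability.LatticeModels.DCPLower (dirRefl)
open Summit.CriticalPhenomena.Ising3DConformalLimit.Theses.CoerciveSharpness (PhiCoercive CoerciveReflectedGradient)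

/-! ### Vocabulary of the line -/

/-- **Box input** (the coercive form of eq. (2.5) of DC–Panis §2.2, weight form): every finite `S`
with `Λ_m ⊆ S ⊆ Λ_{n-1}` satisfies `1 ≤ w Σ_{x ∈ S} #{y ∉ S : y ∼ x} ⟨σ₀σ_x⟩^free_{S,β}`.
`PhiCoercive` gives it at `β_c(3)` with `w = β_c/(c m^κ)`. -/
def BoxInput (d : ℕ) (β w : ℝ) (m n : ℕ) : Prop :=
  ∀ S : Finset (Site d), box d m ⊆ S → S ⊆ box d (n - 1) →
    1 ≤ w * ∑ x ∈ S, ((((zdGraph d).neighborFinset x).filter fun y => y ∉ S).card : ℝ) *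
      isingTwoPoint (zdGraph d) S β 0 .free 0 x

/-- **Stub A statement (registered as `Sig.stub_boxPointwise`) — the pointwise inequality with a base box** (DC–Panis (2.20)–(2.24), one
current configuration, abstract connection predicates `c_δ` as in `DCPNearCritical.pointwise_master_weight`):
`1 ≤ Σ_{z ∈ Λ_m} Σ_δ 𝟙[c_δ z] + w Σ_δ Σ_{x,y ∈ Λ_n} 𝟙[y ∼ x, ¬c_δ 0, ¬c_δ x, c_δ y] ⟨σ_0̄σ_x̄⟩_{W_δ}`. -/
def Sig.stub_boxPointwise : Prop :=
  ∀ (d L : ℕ) [NeZero L] (m n : ℕ), 1 ≤ m → m < n → 2 * n + 1 < L → ∀ (β w : ℝ), 0 ≤ β → 0 ≤ w →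
    BoxInput d β w m n → ∀ (c : Fin d × Bool → Site d → Prop),
    (∀ z ∈ box d n, ∀ i : Fin d, (z i = n → c (i, true) z) ∧ (z i = -(n : ℤ) → c (i, false) z)) →
    (1 : ℝ) ≤ (∑ z ∈ box d m, ∑ δ : Fin d × Bool, if c δ z then (1 : ℝ) else 0) +
      w * ∑ δ : Fin d × Bool, ∑ x ∈ box d n, ∑ y ∈ box d n,
        if (zdGraph d).Adj x y ∧ ¬ c δ 0 ∧ ¬ c δ x ∧ c δ y then
          isingTwoPoint (torusGraph d L) (((box d n).filter fun z => ¬ c δ z).image (Torus.proj L)) β 0 .free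
            (Torus.proj L 0) (Torus.proj L x)
        else 0

/-- **Stub B statement — the torus inequality with a base box** (integration of stub A against the
sourceless current of the even torus `(ℤ/Lℤ)^d`, `L ≥ 4n+2`; Lemma 2.4 in current form at every base
point `z ∈ Λ_m`, Lemma 2.5 per pair, `Hle`; cf. `DCPNearCritical.torusIneq_of_lemma25_weight`):
`1 ≤ Σ_δ ( Σ_{z ∈ Λ_m} ⟨σ_z̄ σ_{θ_δ z̄}⟩_{𝕋_L} + w Σ_{x,y ∈ Λ_n, y∼x} (⟨σ_0̄σ_x̄⟩ - ⟨σ_0̄σ_{θ_δ x̄}⟩)⟨σ_ȳσ_{θ_δ ȳ}⟩ )`. -/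
def BoxTorusIneq : Prop :=
  ∀ (d L : ℕ) [NeZero L], Even L → ∀ (m n : ℕ), 1 ≤ m → m < n → 4 * n + 2 ≤ L → ∀ (β w : ℝ), 0 ≤ β → 0 ≤ w →
    BoxInput d β w m n →
    (1 : ℝ) ≤ ∑ δ : Fin d × Bool,
      ((∑ z ∈ box d m, isingTwoPoint (torusGraph d L) univ β 0 .free (Torus.proj L z) (Torus.proj L (dirRefl δ n z))) +
        w * ∑ x ∈ box d n, ∑ y ∈ box d n,
          if (zdGraph d).Adj x y then
            (isingTwoPoint (torusGraph d L) univ β 0 .free (Torus.proj L 0) (Torus.proj L x) -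
                isingTwoPoint (torusGraph d L) univ β 0 .free (Torus.proj L 0) (Torus.proj L (dirRefl δ n x))) *
              isingTwoPoint (torusGraph d L) univ β 0 .free (Torus.proj L y) (Torus.proj L (dirRefl δ n y))
          else 0)

/-- **Stub C statement — the infinite-volume inequality with a base box** (`L → ∞` along the even
tori at `m*(β) = 0`, i.e. `0 ≤ β ≤ β_c`, `d ≥ 3`; cf. `DCPNearCritical.infiniteVolume_ineq_of_lemma25`):
`1 ≤ Σ_δ ( Σ_{z ∈ Λ_m} ⟨σ₀σ_{𝓡_δ z - z}⟩_β + w Σ_{x,y ∈ Λ_n, y∼x} (⟨σ₀σ_x⟩_β - ⟨σ₀σ_{𝓡_δ x}⟩_β)⟨σ₀σ_{𝓡_δ y - y}⟩_β )`. -/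
def BoxInfiniteVolume : Prop :=
  ∀ (d : ℕ), 3 ≤ d → ∀ (β : ℝ), 0 ≤ β → β ≤ criticalBeta d → ∀ (m n : ℕ), 1 ≤ m → m < n →
    ∀ (w : ℝ), 0 ≤ w → BoxInput d β w m n →
    (1 : ℝ) ≤ ∑ δ : Fin d × Bool, ((∑ z ∈ box d m, twoPointFree d β (dirRefl δ n z - z)) +
      w * ∑ x ∈ box d n, ∑ y ∈ box d n,
        if (zdGraph d).Adj x y then
          (twoPointFree d β x - twoPointFree d β (dirRefl δ n x)) * twoPointFree d β (dirRefl δ n y - y)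
        else 0)

/-- **Stub B, registered form**: the pointwise inequality (stub A) implies the torus inequality. -/
def Sig.stub_boxTorus : Prop :=
  Sig.stub_boxPointwise → BoxTorusIneq

/-- **Stub C, registered form**: the torus inequality implies the infinite-volume inequality. -/
def Sig.stub_boxInfiniteVolume : Prop :=
  BoxTorusIneq → BoxInfiniteVolume

/-- **Stub D statement — the head is small** (union bound over the base box + the infrared bound
`⟨σ₀σ_x⟩_{β_c} ≤ C₀/‖x‖` on `ℤ³`, `twoPointFree_le_of_le_criticalBeta`; `‖𝓡_δ z - z‖ = 2|±n - z_δ| ≥ 2(n-m) ≥ n`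
for `z ∈ Λ_m`, `2m ≤ n`; `#Λ_m · 2d = 6(2m+1)³ ≤ 162 m³`). -/
def Sig.stub_headSmall : Prop :=
  ∃ C : ℝ, 0 < C ∧ ∀ m n : ℕ, 1 ≤ m → 2 * m ≤ n →
    ∑ δ : Fin 3 × Bool, ∑ z ∈ box 3 m, twoPointFree 3 (criticalBeta 3) (dirRefl δ n z - z) ≤
      C * (m : ℝ) ^ 3 / (n : ℝ)

/-- The crux's reflected gradient `Q(n)` on `ℤ³` at `β_c`, VERBATIM the right-hand side of the
consequent of `CoerciveSharpness.CoerciveReflectedGradient` (sum over `x ∈ Λ_n` and the `2d` neighbours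
`x ± e_i ∈ Λ_n`; reflection `𝓡_n` written out as `Function.update · 0 (2n - ·₀)`). -/
def Qcrux (n : ℕ) : ℝ :=
  ∑ x ∈ Literature.Probability.LatticeModels.box 3 n, ∑ i : Fin 3, ((if x + Pi.single i 1 ∈ Literature.Probability.LatticeModels.box 3 n then (Literature.Probability.LatticeModels.twoPointFree 3 (Literature.Probability.LatticeModels.criticalBeta 3) x - Literature.Probability.LatticeModels.twoPointFree 3 (Literature.Probability.LatticeModels.criticalBeta 3) (Function.update x (0 : Fin 3) (2 * (n : ℤ) - x 0))) * Literature.Probability.LatticeModels.freeExpect 3 (Literature.Probability.LatticeModels.criticalBeta 3) 0 (Literature.Probability.LatticeModels.spinPair (x + Pi.single i 1) (Function.update (x + Pi.single i 1) (0 : Fin 3) (2 * (n : ℤ) - (x + Pi.single i 1 : Literature.Probability.LatticeModels.Site 3) 0))) else 0) + (if x - Pi.single i 1 ∈ Literature.Probability.LatticeModels.box 3 n then (Literature.Probability.LatticeModels.twoPointFree 3 (Literature.Probability.LatticeModels.criticalBeta 3) x - Literature.Probability.LatticeModels.twoPointFree 3 (Literature.Probability.LatticeModels.criticalBeta 3)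 (Function.update x (0 : Fin 3) (2 * (n : ℤ) - x 0))) * Literature.Probability.LatticeModels.freeExpect 3 (Literature.Probability.LatticeModels.criticalBeta 3) 0 (Literature.Probability.LatticeModels.spinPair (x - Pi.single i 1) (Function.update (x - Pi.single i 1) (0 : Fin 3) (2 * (n : ℤ) - (x - Pi.single i 1 : Literature.Probability.LatticeModels.Site 3) 0))) else 0))

/-- **Certificate (registered glue sub-goal)**: `Qcrux` IS the crux's reflected gradient — the crux
`CoerciveSharpness.CoerciveReflectedGradient` reads `PhiCoercive → ∃ κ' c₀ > 0, ∃ N₀, ∀ n ≥ N₀, c₀ n^κ' ≤ Qcrux n`,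
definitionally (`Iff.rfl`). Used by the skeleton's glue to hand the crux consequent to `stub_growthSelection`. -/
theorem coerciveReflectedGradient_iff_qcrux :
    CoerciveReflectedGradient ↔ (PhiCoercive → ∃ κ' c₀ : ℝ, 0 < κ' ∧ 0 < c₀ ∧ ∃ N₀ : ℕ, ∀ n : ℕ, N₀ ≤ n → c₀ * (n : ℝ) ^ κ' ≤ Qcrux n) :=
  Iff.rfl

/-- **Stub E statement — direction symmetry and re-indexing**: the `2d = 6` direction terms of the
infinite-volume inequality on `ℤ³` at `β_c` are all equal (`DCPNearCritical.direction_sum_eq`,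
hyperoctahedral invariance) and the tree's `Σ_{x,y ∈ Λ_n, y ∼ x}` is the crux's `Σ_x Σ_i (x ± e_i)`
(`neighborFinset_zdGraph_eq_image`, `single_signedUnit_injective`; `⟨σ_yσ_{𝓡y}⟩ = ⟨σ₀σ_{𝓡y-y}⟩` by
`freePair_eq_twoPointFree_sub`; `dirRefl (0,+) n = dcpReflect 0 n = Function.update · 0 (2n - ·₀)`). -/
def Sig.stub_reflectedSumIdentity : Prop :=
  ∀ n : ℕ, ∑ δ : Fin 3 × Bool, ∑ x ∈ box 3 n, ∑ y ∈ box 3 n,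
      (if (zdGraph 3).Adj x y then
        (twoPointFree 3 (criticalBeta 3) x - twoPointFree 3 (criticalBeta 3) (dirRefl δ n x)) *
          twoPointFree 3 (criticalBeta 3) (dirRefl δ n y - y)
      else 0) = 6 * Qcrux n

/-- **Stub F statement — scale selection** (pure real analysis): if `c m^κ ≤ c m^κ · (C m³/n) + A·Q(n)`
for all `1 ≤ m`, `2m ≤ n`, then choosing `m = ⌊(n/(2C))^{1/3}⌋` gives `Q(n) ≥ c₀ n^{κ/3}` for `n ≥ N₀`
(`c₀ = (c/2A)·2^{-κ}(2C)^{-κ/3}`, `N₀ = max(⌈16C⌉, ⌈2/√C⌉ + 1)`). -/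
def Sig.stub_growthSelection : Prop :=
  ∀ (Q : ℕ → ℝ) (κ c C A : ℝ), 0 < κ → 0 < c → 0 < C → 0 < A →
    (∀ m n : ℕ, 1 ≤ m → 2 * m ≤ n →
      c * (m : ℝ) ^ κ ≤ c * (m : ℝ) ^ κ * (C * (m : ℝ) ^ 3 / (n : ℝ)) + A * Q n) →
    ∃ κ' c₀ : ℝ, 0 < κ' ∧ 0 < c₀ ∧ ∃ N₀ : ℕ, ∀ n : ℕ, N₀ ≤ n → c₀ * (n : ℝ) ^ κ' ≤ Q n

end Summit.CriticalPhenomena.Ising3DConformalLimit.Cruxes.CoerciveReflectedGradient.BaseBoxRerun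

end
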